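/-
Copyright (c) 2026 the pub-hodgecm-mathlib formalisation cell (harness21).  Prover seat hodgecm-mathlib-K2E3-p03 (g6), Track B «K2-LIT» ∕ h413
(`stmt-HodgeConjecture-24833`), line `K2_E3_EllipticInputs`, road (11-3-split-nsc), leaf (nsc-S-A′) `sig_K2E3GL3PrincipalBlockStandardSpan` (owner K2E3-p25 (g0)),
line «IH-x×x×x» (lead K2E3-p11 (g6); dealer K2E3-plan (g4) D71), brick IH-1: THE BRUHAT–IWAHORI DECOMPOSITION `GL_n(F) = ⨆_{σ ∈ S_n} B · P_σ · Iw` AND THE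
IWAHORI-FIXED VECTORS OF AN UNRAMIFIED PRINCIPAL SERIES.  2026-09-04.
-/
import Literature.NumberTheory.Automorphic.IwahoriGL                          -- ★ `iwahoriGL`, `glIntReduction`, `mem_parahoricGL_iff_reduction`, `isOpen_iwahoriGL`
import Literature.NumberTheory.Automorphic.IwasawaDecompositionGL             -- ★ Iwasawa `exists_borel_mul_glInt`; brings ★ `permGL`, `liftTable` (HeckeTransversalGL)
import Literature.NumberTheory.Automorphic.ParabolicBruhatCellsGL             -- ★ Bruhat over a field + SW-rank invariants `swRank_*`, `comp_symm_eq_of_blockCount_eq`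
import Literature.NumberTheory.Automorphic.SmoothInductionDoubleCosetFixed    -- ★ MACKEY (M2)∕(M3)∕(M4) for `(Ind_H^G σ)^K` along `G = ⨆ H gᵢ K`
import Literature.NumberTheory.Automorphic.ParabolicIndGLSphericalUnramified  -- ★ `rootDeltaChar_eq_one_of_mem_glInt` (`δ_B^{1∕2} = 1` on `B ∩ GL_n(𝒪)`)
import Literature.NumberTheory.Automorphic.ParabolicInduction                 -- ★ instance `LocallyCompactSpace ↥P_c`; `parabolicIndGL`
import HarnessLib

/-!
# K2_E3 road (h413), leaf (nsc-S-A′), line «IH-x×x×x», brick IH-1: `GL_n(F) = ⨆_{σ ∈ S_n} B · P_σ · Iw` (Bruhat–Iwahori) and the basis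
# `φ_σ = 1_{B P_σ Iw} · (χ δ_B^{1∕2})` of the Iwahori-fixed vectors of an unramified principal series (`dim = n!`, `= 6` for `GL₃`)

Cell `pub/hodgecm-mathlib` (D-0151), Track B, seat K2E3-p03 (g6); line lead K2E3-p11 (g6), architect K2E3-p25 (g0) (`MEMO-H4-residues.v1` §2, route (H)
«Iwahori–Hecke 6×6»: IH-1 ∥ IH-3 → IH-2 → IH-4 → IH-5 exporting `isIrreducible_parabolicIndGL_id_three_self`).  `--supports stmt-HodgeConjecture-24833 --as helper`;
THEOREMS ONLY (no definition ∕ instance ∕ notation ∕ named fact ∕ `sorry`); never imports `Cruxes/…/Lines`.  COUNT-NEUTRAL helper, GENERIC in `n`.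

NOTATION (spelled out inline).  `F` a non-archimedean local field (§1–§3 only use the valuation ring `𝒪 = 𝒪[F]`, residue field `𝓀 = 𝓀[F]`), `B = standardParabolicGL F id`
(upper triangular Borel), `Iw = iwahoriGL n F` (★ `IwahoriGL`: elements of `GL_n(𝒪)` upper triangular mod `𝓂`), `P_σ = permGL σ` (★ `HeckeTransversalGL`, `(P_σ)_{ij} = [σ i = j]`),
`red : GL_n(𝒪) → GL_n(𝓀)` (★ `glIntReduction`).

THE MATHEMATICS [IwahoriMatsumoto1965, §2 Prop. 2.4, Thm. 2.5 («`G = ⋃ B w B`» for the Iwahori `B`)]; [BruhatTits1972, (4.4.3)–(4.4.4)]; [Casselman1980, §3]; [Borel1976, §3–§4].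
* §1 Reduction mod `𝓂`: `red P_σ = P_σ` (`glIntReduction_permGL`); an integral upper triangular matrix reduces into `B(𝓀)`; **lifting** `B(𝓀) → B(F) ∩ GL_n(𝒪)` along `red`
  (`exists_borel_glInt_glIntReduction_eq`: lift the entries by ★ `liftTable`, the diagonal lifts are units, `det = ∏ diag`).
* §2 **COVER** `exists_eq_borel_mul_permGL_mul_iwahori`: `g = b₀ k` (★ Iwasawa), `red k = β P_σ υ` (★ Bruhat over the FIELD `𝓀`), lift `β` to `b`; then
  `κ := (b P_σ)⁻¹ k ∈ GL_n(𝒪)` reduces to `υ ∈ U(𝓀) ≤ B(𝓀)`, i.e. `κ ∈ Iw`, and `g = (b₀ b) P_σ κ` — in EXACTLY the `hcover` shape of ★ MACKEY (`SmoothInductionDoubleCosetFixed`).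
* §3 **DISJOINTNESS** `eq_of_permGL_eq_borel_mul_permGL_mul_iwahori`: `P_τ = b P_σ κ` forces `b ∈ GL_n(𝒪)`, reduce: `P_τ = β P_σ κ̄` with `β, κ̄ ∈ B(𝓀)`; the south-west
  ranks of ★ `ParabolicBruhatCellsGL` are `B × B`-bi-invariant (`swRank_mul_borel`, this file) and separate permutation matrices (★ `swRank_permMatrix`,
  `comp_symm_eq_of_blockCount_eq`), so `σ = τ` (the `hdisj` shape of ★ MACKEY).
* §4 **THE IWAHORI-FIXED VECTORS OF `I(χ) = parabolicIndGL F id (𝟙.twist χ)`** for `χ` UNRAMIFIED (`hχ : χ m = 1` whenever `diag m ∈ GL_n(𝒪)`): the inducing character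
  `(χ ∘ proj) · δ_B^{1∕2}` is trivial on `B ∩ P_σ Iw P_σ⁻¹ ⊆ B ∩ GL_n(𝒪)` (★ `rootDeltaChar_eq_one_of_mem_glInt`), so ★ (M3) gives, for every value family
  `c : S_n → ℂ`, a unique `Iw`-fixed `φ` with `φ(P_τ) = c τ` (`exists_mem_fixedPoints_forall_toFun_permGL_eq`, `eq_of_forall_toFun_permGL_eq`), in particular the
  basis vectors `φ_σ` (`φ_σ(P_τ) = [τ = σ]`, `exists_iwahoriBasisFun`), and ★ (M4) gives **`finrank ℂ I(χ)^{Iw} = |S_n| = n!`** (`finrank_fixedPoints_iwahori`).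
  IH-2 (Hecke operators `T_{s}`, `R`) types against `ψ_w := φ_{w⁻¹}`; IH-5 consumes `finrank` at `n = 3` (`= 6`).
HONEST LABEL: HC_CM is proved only modulo the 7 printed citations (2 remaining named inputs: hLiu418 = stmt-HodgeConjecture-24832, h413 = stmt-HodgeConjecture-24833)
until rung 0 closes; count-neutral helper (structure theory; no printed citation is discharged).

## Mathlib ∕ tree search
Tree ★: `iwahoriGL`∕`mem_parahoricGL_iff_reduction`∕`glIntReduction`∕`glIntReduction_apply_eq_zero_iff`∕`_eq_one_iff`∕`isOpen_iwahoriGL` (IwahoriGL) · `exists_borel_mul_glInt` (Iwasawa) ·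
`permGL`∕`permMatrix_apply'`∕`permGL_mem_glInt`∕`liftTable`∕`liftTable_eq_zero_iff`∕`residue_liftTable`∕`mem_glInt_of_isIntegralMatrix` (HeckeTransversalGL) · `exists_eq_borel_mul_permGL_mul_upperUnitriangular`
(BruhatDecompositionGL) · `swRank_parabolic_mul`∕`submatrix_mul_of_upperTriangular`∕`swRank_permMatrix`∕`comp_symm_eq_of_blockCount_eq` (ParabolicBruhatCellsGL) · MACKEY (M2)∕(M3)∕(M4)
(SmoothInductionDoubleCosetFixed) · `rootDeltaChar_eq_one_of_mem_glInt`.  Mathlib: `Matrix.det_of_upperTriangular`, `GeneralLinearGroup.mkOfDetNeZero`, `rank_mul_eq_left_of_isUnit_det`.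
Dedup: `rg "permGL_mul_iwahori|iwahoriBasis|fixedPoints_iwahori|glIntReduction_permGL"` over `Literature Summits` — no hits (the `U(3)` twins ★ `K2E3PSIwahoriBasis` ∕ ★ `UnitaryBruhatIwahoriThree`).

## References
* [IwahoriMatsumoto1965] N. Iwahori, H. Matsumoto, *On some Bruhat decomposition and the structure of the Hecke rings of p-adic Chevalley groups*, Publ. Math. IHÉS 25 (1965), §2.
* [BruhatTits1972] F. Bruhat, J. Tits, *Groupes réductifs sur un corps local I*, Publ. Math. IHÉS 41 (1972), (4.4.3)–(4.4.4).
* [Casselman1980] W. Casselman, Compositio Math. 40 (1980), §3.  * [Borel1976] A. Borel, Invent. Math. 35 (1976), §3–§4.  * [CartierCorvallis1979] P. Cartier, PSPM 33.1 (1979), §III.3, §IV.1.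
* [MalleTesterman2011] G. Malle, D. Testerman, *Linear Algebraic Groups and Finite Groups of Lie Type* (2011), Thm. 11.17.  * [BernsteinZelevinsky1977] Ann. Sci. ÉNS 10 (1977), §2.1.
-/

set_option autoImplicit false
-- the mandated namespace repeats the single-problem summit's segment (`HodgeConjecture.HodgeConjecture`)
set_option linter.dupNamespace false

noncomputable section

open Matrix
open scoped MatrixGroups
open Literature.NumberTheory.Automorphic ValuativeRel

namespace Summit.HodgeConjecture.HodgeConjecture.Cruxes.H413.K2E3GL3IwahoriBruhat

universe u

/-! ## §1 Reduction mod `𝓂`: permutation matrices, the Borel, lifting `B(𝓀) → B(F) ∩ GL_n(𝒪)` -/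

section Reduction

variable {F : Type u} [Field F] [ValuativeRel F] {n : ℕ}

/-- **`red P_σ = P_σ`**: the reduction mod `𝓂` of a permutation matrix is the same permutation matrix over the residue field (its entries are `0` and `1`).
[cite: IwahoriMatsumoto1965, §2 Prop. 2.4] -/
theorem glIntReduction_permGL (σ : Equiv.Perm (Fin n)) :
    glIntReduction n F ⟨permGL σ, permGL_mem_glInt σ⟩ = (permGL σ : GL (Fin n) 𝓀[F]) := by
  refine Units.ext ?_
  ext i j
  conv_rhs => rw [coe_permGL, permMatrix_apply']
  by_cases h : σ i = j
  · rw [if_pos h, glIntReduction_apply_eq_one_iff]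
    change valuation F (((permGL σ : GL (Fin n) F) : Matrix (Fin n) (Fin n) F) i j - 1) < 1
    rw [coe_permGL, permMatrix_apply', if_pos h, sub_self, map_zero]
    exact zero_lt_one
  · rw [if_neg h, glIntReduction_apply_eq_zero_iff]
    change valuation F (((permGL σ : GL (Fin n) F) : Matrix (Fin n) (Fin n) F) i j) < 1
    rw [coe_permGL, permMatrix_apply', if_neg h, map_zero]
    exact zero_lt_one

/-- An INTEGRAL UPPER TRIANGULAR matrix reduces into the Borel `B(𝓀)`. [cite: IwahoriMatsumoto1965, §2 Prop. 2.4] -/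
theorem glIntReduction_mem_borel {b : GL (Fin n) F} (hb : b ∈ glInt n F) (hbB : b ∈ standardParabolicGL F (id : Fin n → Fin n)) :
    glIntReduction n F ⟨b, hb⟩ ∈ standardParabolicGL 𝓀[F] (id : Fin n → Fin n) := by
  rw [mem_standardParabolicGL_iff]
  intro i j hij
  rw [glIntReduction_apply_eq_zero_iff]
  change valuation F ((b : Matrix (Fin n) (Fin n) F) i j) < 1
  rw [(mem_standardParabolicGL_iff (id : Fin n → Fin n) b).1 hbB hij, map_zero]
  exact zero_lt_one

/-- An element of the Iwahori subgroup reduces into the Borel `B(𝓀)` (the definition of `Iw = red⁻¹(B(𝓀))`). [cite: IwahoriMatsumoto1965, §2 Prop. 2.4] -/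
theorem glIntReduction_mem_borel_of_mem_iwahori {κ : GL (Fin n) F} (hκ : κ ∈ iwahoriGL n F) (hκ' : κ ∈ glInt n F) :
    glIntReduction n F ⟨κ, hκ'⟩ ∈ standardParabolicGL 𝓀[F] (id : Fin n → Fin n) := by
  obtain ⟨_, h⟩ := (mem_parahoricGL_iff_reduction κ).1 hκ
  exact h

/-- Conversely an element of `GL_n(𝒪)` reducing into `B(𝓀)` lies in `Iw`. [cite: IwahoriMatsumoto1965, §2 Prop. 2.4] -/
theorem mem_iwahori_of_glIntReduction_mem_borel {κ : GL (Fin n) F} (hκ' : κ ∈ glInt n F)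
    (h : glIntReduction n F ⟨κ, hκ'⟩ ∈ standardParabolicGL 𝓀[F] (id : Fin n → Fin n)) : κ ∈ iwahoriGL n F :=
  (mem_parahoricGL_iff_reduction κ).2 ⟨hκ', h⟩

/-- **LIFTING `B(𝓀) → B(F) ∩ GL_n(𝒪)`**: every invertible upper triangular matrix over the residue field is the reduction of an integral upper triangular matrix with
integral inverse (lift the entries by ★ `liftTable`, which lifts `0` to `0`; the diagonal entries of `β` are non-zero since `det β = ∏ β_{ii}`, so their lifts are units and
`det = ∏ diag` has valuation `1`). [cite: IwahoriMatsumoto1965, §2 Prop. 2.4] -/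
theorem exists_borel_glInt_glIntReduction_eq (β : GL (Fin n) 𝓀[F]) (hβ : β ∈ standardParabolicGL 𝓀[F] (id : Fin n → Fin n)) :
    ∃ b : GL (Fin n) F, ∃ hb : b ∈ glInt n F, b ∈ standardParabolicGL F (id : Fin n → Fin n) ∧ glIntReduction n F ⟨b, hb⟩ = β := by
  classical
  have hβtri : (β : Matrix (Fin n) (Fin n) 𝓀[F]).BlockTriangular id := (mem_standardParabolicGL_iff _ β).1 hβ
  -- the lifted matrix
  set M : Matrix (Fin n) (Fin n) F := Matrix.of (liftTable fun i j => (β : Matrix (Fin n) (Fin n) 𝓀[F]) i j) with hM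
  have hMapply : ∀ i j, M i j = liftTable (fun i j => (β : Matrix (Fin n) (Fin n) 𝓀[F]) i j) i j := fun i j => rfl
  have hMint : IsIntegralMatrix M := fun i j => by rw [hMapply]; exact liftTable_mem _ i j
  have hMtri : M.BlockTriangular id := by
    intro i j hij
    rw [hMapply, liftTable_eq_zero_iff]
    exact hβtri hij
  -- the diagonal entries of `β` are non-zero, so those of `M` are units
  have hdet : (β : Matrix (Fin n) (Fin n) 𝓀[F]).det ≠ 0 := by
    have hu : IsUnit (β : Matrix (Fin n) (Fin n) 𝓀[F]).det := by
      rw [← Matrix.GeneralLinearGroup.val_det_apply]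
      exact Units.isUnit _
    exact hu.ne_zero
  have hdiagβ : ∀ i, (β : Matrix (Fin n) (Fin n) 𝓀[F]) i i ≠ 0 := by
    intro i h0
    apply hdet
    rw [Matrix.det_of_upperTriangular hβtri]
    exact Finset.prod_eq_zero (Finset.mem_univ i) h0
  have hdiag : ∀ i, valuation F (M i i) = 1 := by
    intro i
    have hle : valuation F (M i i) ≤ 1 := (Valuation.mem_integer_iff _ _).1 (hMint i i)
    refine le_antisymm hle (not_lt.1 fun hlt => hdiagβ i ?_)
    rw [← residue_liftTable (fun i j => (β : Matrix (Fin n) (Fin n) 𝓀[F]) i j) i i]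
    exact (residue_eq_zero_iff_valuation_lt_one _).2 hlt
  have hdetM : valuation F M.det = 1 := by
    rw [Matrix.det_of_upperTriangular hMtri, map_prod]
    exact Finset.prod_eq_one fun i _ => hdiag i
  have hdetM0 : M.det ≠ 0 := fun h => by rw [h, map_zero] at hdetM; exact zero_ne_one hdetM
  refine ⟨Matrix.GeneralLinearGroup.mkOfDetNeZero M hdetM0, mem_glInt_of_isIntegralMatrix hMint hdetM, hMtri, ?_⟩
  refine Units.ext ?_
  ext i j
  rw [coe_glIntReduction_apply]
  exact residue_liftTable (fun i j => (β : Matrix (Fin n) (Fin n) 𝓀[F]) i j) i j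

end Reduction

/-! ## §2 The cover `GL_n(F) = ⋃_σ B · P_σ · Iw` -/

section Cover

variable {F : Type u} [Field F] [ValuativeRel F] {n : ℕ}

/-- The upper unitriangular group is contained in the Borel. [cite: BernsteinZelevinsky1977, §2.1] -/
theorem upperUnitriangular_le_borel {K : Type*} [Field K] :
    upperUnitriangular (Fin n) K ≤ standardParabolicGL K (id : Fin n → Fin n) :=
  fun u hu => (mem_standardParabolicGL_iff _ u).2 ((mem_upperUnitriangular_iff u).1 hu).1

/-- **THE BRUHAT–IWAHORI COVER `GL_n(F) = ⋃_{σ ∈ S_n} B · P_σ · Iw`** (Iwasawa `g = b₀ k` ★, Bruhat for `red k` over the residue FIELD ★, lifting §1), in the `hcover`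
shape of ★ MACKEY `Representation.exists_mem_fixedPoints_forall_toFun_eq`. [cite: IwahoriMatsumoto1965, §2 Thm. 2.5] [cite: BruhatTits1972, (4.4.3)] -/
theorem exists_eq_borel_mul_permGL_mul_iwahori (g : GL (Fin n) F) :
    ∃ σ : Equiv.Perm (Fin n), ∃ b : ↥(standardParabolicGL F (id : Fin n → Fin n)), ∃ κ ∈ iwahoriGL n F,
      g = (b : GL (Fin n) F) * permGL σ * κ := by
  classical
  obtain ⟨b₀, hb₀, k, hk, rfl⟩ := exists_borel_mul_glInt g
  obtain ⟨β, σ, υ, hβ, hred⟩ := exists_eq_borel_mul_permGL_mul_upperUnitriangular (glIntReduction n F ⟨k, hk⟩)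
  obtain ⟨b, hb, hbB, hbred⟩ := exists_borel_glInt_glIntReduction_eq β hβ
  have hκint : (b * permGL σ)⁻¹ * k ∈ glInt n F :=
    mul_mem (inv_mem (mul_mem hb (permGL_mem_glInt σ))) hk
  have hκred : glIntReduction n F ⟨(b * permGL σ)⁻¹ * k, hκint⟩ = (υ : GL (Fin n) 𝓀[F]) := by
    have hsub : (⟨(b * permGL σ)⁻¹ * k, hκint⟩ : glInt n F) =
        (⟨b, hb⟩ * ⟨permGL σ, permGL_mem_glInt σ⟩)⁻¹ * ⟨k, hk⟩ := rfl
    rw [hsub, map_mul, map_inv, map_mul, hbred, glIntReduction_permGL, hred]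
    group
  have hκ : (b * permGL σ)⁻¹ * k ∈ iwahoriGL n F :=
    mem_iwahori_of_glIntReduction_mem_borel hκint (by rw [hκred]; exact upperUnitriangular_le_borel υ.2)
  refine ⟨σ, ⟨b₀ * b, mul_mem hb₀ hbB⟩, (b * permGL σ)⁻¹ * k, hκ, ?_⟩
  rw [Subgroup.coe_mk]
  group

end Cover

/-! ## §3 Disjointness: `B · P_σ · Iw = B · P_τ · Iw ⟹ σ = τ` -/

section Disjoint

variable {n : ℕ}

/-- The column corner `u[C_j, C_j]` (`C_j = {k < j}`) of an invertible UPPER TRIANGULAR `u` is invertible (its inverse is the corner of `u⁻¹`). [folklore] -/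
theorem isUnit_det_submatrix_of_mem_borel {K : Type*} [Field K] {u : GL (Fin n) K}
    (hu : u ∈ standardParabolicGL K (id : Fin n → Fin n)) (j : ℕ) :
    IsUnit ((u : Matrix (Fin n) (Fin n) K).submatrix (Subtype.val : {k : Fin n // (k : ℕ) < j} → Fin n) Subtype.val).det := by
  have hu' : ((u⁻¹ : GL (Fin n) K) : Matrix (Fin n) (Fin n) K).BlockTriangular id :=
    (mem_standardParabolicGL_iff _ _).1 (Subgroup.inv_mem _ hu)
  have h := submatrix_mul_of_upperTriangular (K := K) hu' (u : Matrix (Fin n) (Fin n) K)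
    (Subtype.val : {k : Fin n // (k : ℕ) < j} → Fin n) j
  rw [← Units.val_mul, mul_inv_cancel, Units.val_one, one_submatrix_subtypeVal] at h
  exact Matrix.isUnit_det_of_right_inverse h.symm

/-- **Right `B`-invariance of the south-west ranks**: `swRank id (g u) = swRank id g` for `u` invertible upper triangular (★ `swRank_mul_upperUnitriangular` for the
whole Borel). [folklore] -/
theorem swRank_mul_borel {K : Type*} [Field K] {u : GL (Fin n) K} (hu : u ∈ standardParabolicGL K (id : Fin n → Fin n))
    (g : Matrix (Fin n) (Fin n) K) (a : Fin n) (j : ℕ) :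
    swRank (id : Fin n → Fin n) (g * (u : Matrix (Fin n) (Fin n) K)) a j = swRank (id : Fin n → Fin n) g a j := by
  unfold swRank swBlock
  rw [submatrix_mul_of_upperTriangular ((mem_standardParabolicGL_iff _ _).1 hu)]
  exact Matrix.rank_mul_eq_left_of_isUnit_det _ _ (isUnit_det_submatrix_of_mem_borel hu j)

/-- **Bruhat disjointness over a field with the Borel on BOTH sides**: `P_τ = β P_σ κ` with `β, κ` invertible upper triangular forces `σ = τ` (the south-west ranks of
`P_τ` and `P_σ` coincide, hence their block counts, hence `τ⁻¹ = σ⁻¹`). [cite: MalleTesterman2011, Thm. 11.17] -/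
theorem eq_of_permGL_eq_borel_mul_permGL_mul_borel {K : Type*} [Field K] {σ τ : Equiv.Perm (Fin n)} {β κ : GL (Fin n) K}
    (hβ : β ∈ standardParabolicGL K (id : Fin n → Fin n)) (hκ : κ ∈ standardParabolicGL K (id : Fin n → Fin n))
    (h : (permGL τ : GL (Fin n) K) = β * permGL σ * κ) : σ = τ := by
  have hrank : swRank (id : Fin n → Fin n) ((permGL τ : GL (Fin n) K) : Matrix (Fin n) (Fin n) K) =
      swRank (id : Fin n → Fin n) ((permGL σ : GL (Fin n) K) : Matrix (Fin n) (Fin n) K) := by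
    funext a j
    rw [h, Units.val_mul, Units.val_mul, swRank_mul_borel hκ, swRank_parabolic_mul (id : Fin n → Fin n) hβ]
  rw [coe_permGL, coe_permGL] at hrank
  have hcount : blockCount (id : Fin n → Fin n) τ = blockCount (id : Fin n → Fin n) σ := by
    funext a j
    rw [← swRank_permMatrix (K := K), ← swRank_permMatrix (K := K), hrank]
  have hcomp := comp_symm_eq_of_blockCount_eq (id : Fin n → Fin n) hcount
  have : τ.symm = σ.symm := by
    ext k
    exact congrArg Fin.val (congrFun hcomp k)
  exact (Equiv.symm_bijective.injective this).symm

variable {F : Type u} [Field F] [ValuativeRel F]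

/-- **DISJOINTNESS OF THE BRUHAT–IWAHORI CELLS**: `P_τ ∈ B · P_σ · Iw ⟹ σ = τ` — `b = P_τ κ⁻¹ P_σ⁻¹` is integral, and reducing mod `𝓂` gives `P_τ = β P_σ κ̄` with
`β, κ̄ ∈ B(𝓀)` (§1); in the `hdisj` shape of ★ MACKEY. [cite: IwahoriMatsumoto1965, §2 Thm. 2.5] [cite: BruhatTits1972, (4.4.4)] -/
theorem eq_of_permGL_eq_borel_mul_permGL_mul_iwahori (σ τ : Equiv.Perm (Fin n))
    (h : ∃ b : ↥(standardParabolicGL F (id : Fin n → Fin n)), ∃ κ ∈ iwahoriGL n F,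
      (permGL τ : GL (Fin n) F) = (b : GL (Fin n) F) * permGL σ * κ) : σ = τ := by
  obtain ⟨b, κ, hκ, h⟩ := h
  have hκint : κ ∈ glInt n F := iwahoriGL_le_glInt n F hκ
  have hbint : (b : GL (Fin n) F) ∈ glInt n F := by
    rw [show (b : GL (Fin n) F) = permGL τ * κ⁻¹ * (permGL σ)⁻¹ by rw [h]; group]
    exact mul_mem (mul_mem (permGL_mem_glInt τ) (inv_mem hκint)) (inv_mem (permGL_mem_glInt σ))
  have hred : (permGL τ : GL (Fin n) 𝓀[F]) =
      glIntReduction n F ⟨b, hbint⟩ * permGL σ * glIntReduction n F ⟨κ, hκint⟩ := by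
    rw [← glIntReduction_permGL τ, ← glIntReduction_permGL σ, ← map_mul, ← map_mul]
    exact congrArg (glIntReduction n F) (Subtype.ext h)
  exact eq_of_permGL_eq_borel_mul_permGL_mul_borel (glIntReduction_mem_borel hbint b.2)
    (glIntReduction_mem_borel_of_mem_iwahori hκ hκint) hred

end Disjoint

/-! ## §4 The Iwahori-fixed vectors of an unramified principal series `I(χ) = parabolicIndGL F id (𝟙.twist χ)` -/

section IwahoriFixed

variable {F : Type} [Field F] [ValuativeRel F] [TopologicalSpace F] [IsNonarchimedeanLocalField F] {n : ℕ}
  (χ : (Π a : Fin n, GL {i : Fin n // (id : Fin n → Fin n) i = a} F) →* ℂˣ)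

/-- **The inducing character `(χ ∘ proj) · δ_B^{1∕2}` is trivial on `B ∩ x Iw x⁻¹` for `x ∈ GL_n(𝒪)`** when `χ` is UNRAMIFIED (`χ ∘ proj = 1` on `B ∩ GL_n(𝒪)`): such an
element of `B` is integral with integral inverse, where `δ_B^{1∕2} = 1` (★ `rootDeltaChar_eq_one_of_mem_glInt`). [cite: Casselman1980, §3] [cite: CartierCorvallis1979, §III.3] -/
theorem inducingChar_apply_eq_one_of_conj_mem_iwahori
    (hχ : ∀ p : ↥(standardParabolicGL F (id : Fin n → Fin n)), (p : GL (Fin n) F) ∈ glInt n F → χ (leviProjection F (id : Fin n → Fin n) p) = 1)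
    {x : GL (Fin n) F} (hx : x ∈ glInt n F) (h : ↥(standardParabolicGL F (id : Fin n → Fin n)))
    (hh : x⁻¹ * (h : GL (Fin n) F) * x ∈ iwahoriGL n F) :
    Representation.twist (((Representation.trivial ℂ (Π a : Fin n, GL {i : Fin n // (id : Fin n → Fin n) i = a} F) ℂ).twist χ).comp
      (leviProjection F (id : Fin n → Fin n))) (rootDeltaChar (standardParabolicGL F (id : Fin n → Fin n))) h = 1 := by
  have hint : (h : GL (Fin n) F) ∈ glInt n F := by
    rw [show (h : GL (Fin n) F) = x * (x⁻¹ * (h : GL (Fin n) F) * x) * x⁻¹ by group]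
    exact mul_mem (mul_mem hx (iwahoriGL_le_glInt n F hh)) (inv_mem hx)
  apply LinearMap.ext
  intro z
  rw [Representation.twist_apply, rootDeltaChar_eq_one_of_mem_glInt h hint, MonoidHom.comp_apply, Representation.twist_apply, hχ h hint,
    Representation.trivial_apply, Units.val_one, one_smul, one_smul, Module.End.one_apply]

/-- **(M3 for `B \\ GL_n ∕ Iw`) every value family is realised**: for `χ` unramified and every `c : S_n → ℂ` there is an `Iw`-fixed vector `φ` of `I(χ)` with `φ(P_τ) = c τ`
for all `τ`, and then `φ(b P_τ κ) = δ_B^{1∕2}(b) χ(proj b) c τ` on the whole cell `B P_τ Iw`. [cite: Casselman1980, §3] [cite: Borel1976, §3–§4] [cite: CartierCorvallis1979, §III.3] -/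
theorem exists_mem_fixedPoints_forall_toFun_permGL_eq
    (hχ : ∀ p : ↥(standardParabolicGL F (id : Fin n → Fin n)), (p : GL (Fin n) F) ∈ glInt n F → χ (leviProjection F (id : Fin n → Fin n) p) = 1)
    (c : Equiv.Perm (Fin n) → ℂ) :
    ∃ φ : Representation.SmoothInd (standardParabolicGL F (id : Fin n → Fin n))
        (Representation.twist (((Representation.trivial ℂ (Π a : Fin n, GL {i : Fin n // (id : Fin n → Fin n) i = a} F) ℂ).twist χ).comp
          (leviProjection F (id : Fin n → Fin n))) (rootDeltaChar (standardParabolicGL F (id : Fin n → Fin n)))),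
      φ ∈ (Representation.parabolicIndGL F (id : Fin n → Fin n)
          ((Representation.trivial ℂ (Π a : Fin n, GL {i : Fin n // (id : Fin n → Fin n) i = a} F) ℂ).twist χ)).fixedPoints (iwahoriGL n F) ∧
      (∀ τ : Equiv.Perm (Fin n), φ.toFun (permGL τ) = c τ) ∧
      ∀ (τ : Equiv.Perm (Fin n)) (b : ↥(standardParabolicGL F (id : Fin n → Fin n))) (κ : GL (Fin n) F), κ ∈ iwahoriGL n F →
        φ.toFun ((b : GL (Fin n) F) * permGL τ * κ) =
          ((rootDeltaChar (standardParabolicGL F (id : Fin n → Fin n)) b : ℂˣ) : ℂ) * ((χ (leviProjection F (id : Fin n → Fin n) b) : ℂˣ) : ℂ) * c τ := by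
  obtain ⟨φ, hφ, hval, hcell⟩ := Representation.exists_mem_fixedPoints_forall_toFun_eq
    (Representation.twist (((Representation.trivial ℂ (Π a : Fin n, GL {i : Fin n // (id : Fin n → Fin n) i = a} F) ℂ).twist χ).comp
      (leviProjection F (id : Fin n → Fin n))) (rootDeltaChar (standardParabolicGL F (id : Fin n → Fin n))))
    (isOpen_iwahoriGL n F) exists_eq_borel_mul_permGL_mul_iwahori eq_of_permGL_eq_borel_mul_permGL_mul_iwahori c (fun i => by
      rw [Representation.mem_fixedPoints]
      intro h hh
      rw [Representation.mem_subgroupOf_map_conj_iff] at hh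
      rw [inducingChar_apply_eq_one_of_conj_mem_iwahori χ hχ (permGL_mem_glInt i) h hh, Module.End.one_apply])
  refine ⟨φ, hφ, hval, fun τ b κ hκ => ?_⟩
  rw [hcell τ b κ hκ, Representation.twist_apply, MonoidHom.comp_apply, Representation.twist_apply, Representation.trivial_apply, smul_eq_mul,
    smul_eq_mul, mul_assoc]

/-- **(M2) an `Iw`-fixed vector of `I(χ)` is determined by its values at the permutation matrices** (any `χ`; only the cover §2 is used).
[cite: Casselman1980, §3] [cite: CartierCorvallis1979, §III.3] -/
theorem eq_of_forall_toFun_permGL_eq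
    {φ φ' : Representation.SmoothInd (standardParabolicGL F (id : Fin n → Fin n))
        (Representation.twist (((Representation.trivial ℂ (Π a : Fin n, GL {i : Fin n // (id : Fin n → Fin n) i = a} F) ℂ).twist χ).comp
          (leviProjection F (id : Fin n → Fin n))) (rootDeltaChar (standardParabolicGL F (id : Fin n → Fin n))))}
    (hφ : φ ∈ (Representation.parabolicIndGL F (id : Fin n → Fin n)
          ((Representation.trivial ℂ (Π a : Fin n, GL {i : Fin n // (id : Fin n → Fin n) i = a} F) ℂ).twist χ)).fixedPoints (iwahoriGL n F))
    (hφ' : φ' ∈ (Representation.parabolicIndGL F (id : Fin n → Fin n)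
          ((Representation.trivial ℂ (Π a : Fin n, GL {i : Fin n // (id : Fin n → Fin n) i = a} F) ℂ).twist χ)).fixedPoints (iwahoriGL n F))
    (h : ∀ τ : Equiv.Perm (Fin n), φ.toFun (permGL τ) = φ'.toFun (permGL τ)) : φ = φ' :=
  Representation.eq_of_forall_toFun_apply_eq _ exists_eq_borel_mul_permGL_mul_iwahori hφ hφ' h

/-- **THE BASIS VECTORS `φ_σ = 1_{B P_σ Iw} · (χ δ_B^{1∕2})`**: for `χ` unramified and each `σ ∈ S_n` there is an `Iw`-fixed `φ_σ ∈ I(χ)` with `φ_σ(P_τ) = [τ = σ]`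
(Casselman's `φ_{w,χ}`). [cite: Casselman1980, §3] [cite: Borel1976, §3–§4] -/
theorem exists_iwahoriBasisFun
    (hχ : ∀ p : ↥(standardParabolicGL F (id : Fin n → Fin n)), (p : GL (Fin n) F) ∈ glInt n F → χ (leviProjection F (id : Fin n → Fin n) p) = 1)
    (σ : Equiv.Perm (Fin n)) :
    ∃ φ : Representation.SmoothInd (standardParabolicGL F (id : Fin n → Fin n))
        (Representation.twist (((Representation.trivial ℂ (Π a : Fin n, GL {i : Fin n // (id : Fin n → Fin n) i = a} F) ℂ).twist χ).comp
          (leviProjection F (id : Fin n → Fin n))) (rootDeltaChar (standardParabolicGL F (id : Fin n → Fin n)))),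
      φ ∈ (Representation.parabolicIndGL F (id : Fin n → Fin n)
          ((Representation.trivial ℂ (Π a : Fin n, GL {i : Fin n // (id : Fin n → Fin n) i = a} F) ℂ).twist χ)).fixedPoints (iwahoriGL n F) ∧
      (∀ τ : Equiv.Perm (Fin n), φ.toFun (permGL τ) = if τ = σ then 1 else 0) ∧
      ∀ (τ : Equiv.Perm (Fin n)) (b : ↥(standardParabolicGL F (id : Fin n → Fin n))) (κ : GL (Fin n) F), κ ∈ iwahoriGL n F →
        φ.toFun ((b : GL (Fin n) F) * permGL τ * κ) =
          if τ = σ then ((rootDeltaChar (standardParabolicGL F (id : Fin n → Fin n)) b : ℂˣ) : ℂ) * ((χ (leviProjection F (id : Fin n → Fin n) b) : ℂˣ) : ℂ) else 0 := by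
  classical
  obtain ⟨φ, hφ, hval, hcell⟩ := exists_mem_fixedPoints_forall_toFun_permGL_eq χ hχ (fun τ => if τ = σ then 1 else 0)
  refine ⟨φ, hφ, hval, fun τ b κ hκ => ?_⟩
  rw [hcell τ b κ hκ]
  split_ifs <;> simp

/-- **THE EVALUATION ISOMORPHISM `I(χ)^{Iw} ≃ (S_n → ℂ)`, `φ ↦ (τ ↦ φ(P_τ))`** for `χ` unramified (★ (M2) injective, ★ (M3) surjective): the coordinates in which IH-2 writes
the Iwahori–Hecke operators. [cite: Casselman1980, §3] [cite: Borel1976, §3–§4] [cite: CartierCorvallis1979, §III.3] -/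
theorem exists_fixedPoints_iwahori_linearEquiv_eval
    (hχ : ∀ p : ↥(standardParabolicGL F (id : Fin n → Fin n)), (p : GL (Fin n) F) ∈ glInt n F → χ (leviProjection F (id : Fin n → Fin n) p) = 1) :
    ∃ e : ↥((Representation.parabolicIndGL F (id : Fin n → Fin n)
          ((Representation.trivial ℂ (Π a : Fin n, GL {i : Fin n // (id : Fin n → Fin n) i = a} F) ℂ).twist χ)).fixedPoints (iwahoriGL n F)) ≃ₗ[ℂ]
        (Equiv.Perm (Fin n) → ℂ),
      ∀ (φ : ↥((Representation.parabolicIndGL F (id : Fin n → Fin n)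
          ((Representation.trivial ℂ (Π a : Fin n, GL {i : Fin n // (id : Fin n → Fin n) i = a} F) ℂ).twist χ)).fixedPoints (iwahoriGL n F)))
        (τ : Equiv.Perm (Fin n)),
        e φ τ = (φ : Representation.SmoothInd (standardParabolicGL F (id : Fin n → Fin n))
          (Representation.twist (((Representation.trivial ℂ (Π a : Fin n, GL {i : Fin n // (id : Fin n → Fin n) i = a} F) ℂ).twist χ).comp
            (leviProjection F (id : Fin n → Fin n))) (rootDeltaChar (standardParabolicGL F (id : Fin n → Fin n))))).toFun (permGL τ) := by
  let ev : ↥((Representation.parabolicIndGL F (id : Fin n → Fin n)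
          ((Representation.trivial ℂ (Π a : Fin n, GL {i : Fin n // (id : Fin n → Fin n) i = a} F) ℂ).twist χ)).fixedPoints (iwahoriGL n F)) →ₗ[ℂ]
        (Equiv.Perm (Fin n) → ℂ) :=
    { toFun := fun φ τ => (φ : Representation.SmoothInd (standardParabolicGL F (id : Fin n → Fin n))
          (Representation.twist (((Representation.trivial ℂ (Π a : Fin n, GL {i : Fin n // (id : Fin n → Fin n) i = a} F) ℂ).twist χ).comp
            (leviProjection F (id : Fin n → Fin n))) (rootDeltaChar (standardParabolicGL F (id : Fin n → Fin n))))).toFun (permGL τ)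
      map_add' := fun φ φ' => funext fun τ => by
        simp only [Submodule.coe_add, Representation.SmoothInd.toFun_add, Pi.add_apply]
      map_smul' := fun a φ => funext fun τ => by
        simp only [Submodule.coe_smul, Representation.SmoothInd.toFun_smul, Pi.smul_apply, smul_eq_mul, RingHom.id_apply] }
  have hinj : Function.Injective ev := fun φ φ' hφφ' =>
    Subtype.ext (eq_of_forall_toFun_permGL_eq χ φ.2 φ'.2 fun τ => congrFun hφφ' τ)
  have hsurj : Function.Surjective ev := fun c => by
    obtain ⟨φ, hφ, hval, -⟩ := exists_mem_fixedPoints_forall_toFun_permGL_eq χ hχ c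
    exact ⟨⟨φ, hφ⟩, funext fun τ => hval τ⟩
  exact ⟨LinearEquiv.ofBijective ev ⟨hinj, hsurj⟩, fun φ τ => rfl⟩

/-- **`dim I(χ)^{Iw} = |S_n| = n!`** for an UNRAMIFIED `χ` (★ MACKEY'S COUNT `finrank_fixedPoints_smoothIndRep_eq_card` along the Bruhat–Iwahori decomposition;
`= 6` for `GL₃`, the dimension of the Iwahori–Hecke module of IH-4). [cite: Casselman1980, §3] [cite: Borel1976, §3–§4] [cite: CartierCorvallis1979, §IV.1] -/
theorem finrank_fixedPoints_iwahori
    (hχ : ∀ p : ↥(standardParabolicGL F (id : Fin n → Fin n)), (p : GL (Fin n) F) ∈ glInt n F → χ (leviProjection F (id : Fin n → Fin n) p) = 1) :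
    Module.finrank ℂ ↥((Representation.parabolicIndGL F (id : Fin n → Fin n)
        ((Representation.trivial ℂ (Π a : Fin n, GL {i : Fin n // (id : Fin n → Fin n) i = a} F) ℂ).twist χ)).fixedPoints (iwahoriGL n F)) =
      Fintype.card (Equiv.Perm (Fin n)) := by
  classical
  exact Representation.finrank_fixedPoints_smoothIndRep_eq_card
    (Representation.twist (((Representation.trivial ℂ (Π a : Fin n, GL {i : Fin n // (id : Fin n → Fin n) i = a} F) ℂ).twist χ).comp
      (leviProjection F (id : Fin n → Fin n))) (rootDeltaChar (standardParabolicGL F (id : Fin n → Fin n))))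
    (isOpen_iwahoriGL n F) exists_eq_borel_mul_permGL_mul_iwahori eq_of_permGL_eq_borel_mul_permGL_mul_iwahori (Module.finrank_self ℂ)
    (fun i h hh => inducingChar_apply_eq_one_of_conj_mem_iwahori χ hχ (permGL_mem_glInt i) h hh)

/-- `dim I(χ)^{Iw} = 6` for `GL₃` (`|S₃| = 3! = 6`). [cite: Casselman1980, §3] [cite: Borel1976, §3–§4] -/
theorem finrank_fixedPoints_iwahori_three {F : Type} [Field F] [ValuativeRel F] [TopologicalSpace F] [IsNonarchimedeanLocalField F]
    (χ : (Π a : Fin 3, GL {i : Fin 3 // (id : Fin 3 → Fin 3) i = a} F) →* ℂˣ)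
    (hχ : ∀ p : ↥(standardParabolicGL F (id : Fin 3 → Fin 3)), (p : GL (Fin 3) F) ∈ glInt 3 F → χ (leviProjection F (id : Fin 3 → Fin 3) p) = 1) :
    Module.finrank ℂ ↥((Representation.parabolicIndGL F (id : Fin 3 → Fin 3)
        ((Representation.trivial ℂ (Π a : Fin 3, GL {i : Fin 3 // (id : Fin 3 → Fin 3) i = a} F) ℂ).twist χ)).fixedPoints (iwahoriGL 3 F)) = 6 := by
  rw [finrank_fixedPoints_iwahori χ hχ, Fintype.card_perm, Fintype.card_fin]
  rfl

end IwahoriFixed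

end Summit.HodgeConjecture.HodgeConjecture.Cruxes.H413.K2E3GL3IwahoriBruhat

end
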